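import Summits.QuantumFields.YangMills.Theorems.BalabanLadderUVSeamRecColdWallBoxCeiling
import Summits.QuantumFields.YangMills.Theorems.BalabanLadderUVSeamRecTorusPeeling
import HarnessLib

/-!
# Crux `UVSeamRec` (stmt-QuantumFields-20043): PEELING IN THE FIBRE of a `ℤ⁴` Yang–Mills kernel —
# `Z_Λ(b; η) ≤ ψ_ρ(b)^{#N}` for every exterior `η` and every triangular family of plaquettes indexed by links `N ⊆ Λ`

Helper file (`--supports stmt-QuantumFields-20043`) of the LEAD seat `ym-spine-20043-p1` (gen 12).  The torus version (`…TorusPeeling`,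
gen 11) peels a triangular family of plaquettes of the four-torus; this file does the same INSIDE THE FIBRE `G^Λ` of the `ℤ⁴` kernel
`γ_Λ(· | η)` (Mathlib `lmarginal` on the finite product `↥Λ → G`), for an ARBITRARY exterior `η`:
* §1 `glueWith_update`, `plaquetteHolonomyZd_update_of_not_mem`, `exists_plaquetteHolonomyZd_update_eq` — updating one link of the fibre: the
  holonomy of a plaquette not containing the link is unchanged, and the holonomy of a plaquette containing it is `a · y^{±1} · c`;
* §2 **`lintegral_fibre_boltzmann_mul`** — the peeling step: `∫ K_b(U_p) g dHaar^Λ = ψ_ρ(b) ∫ g dHaar^Λ` when `g` does not depend on a link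
  `ℓ ∈ Λ` of `p` (`K_b(V) = e^{−b(N − Re tr ρ V)}`, `ψ_ρ(b) = ∫ K_b dHaar`);
* §3 **`lintegral_fibre_prod_boltzmann_eq`** — a family `ℓ ↦ pl ℓ` (`ℓ ∈ N ⊆ Λ`, `ℓ` an edge of `pl ℓ`) which is TRIANGULAR for a rank `τ`
  (`ℓ ∈ pl ℓ'`, `ℓ ≠ ℓ'` ⇒ `τ ℓ < τ ℓ'`) peels completely: `∫ ∏_{ℓ∈N} K_b(U_{pl ℓ}) dHaar^Λ = ψ_ρ(b)^{#N}`;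
* §4 **`fibreIntegral_exp_neg_mul_le_pow`** — hence `Z_Λ(b; η) := ∫ e^{−b S_Λ(ζ ∨ η)} dHaar^Λ(ζ) ≤ ψ_ρ(b)^{#N}` for `b ≥ 0` (drop the other
  plaquettes, whose costs are `≥ 0`), and the `SU(2)` reading `≤ (3/(b√b))^{#N}` (`…TorusLaplaceSU2`).
The cube's complete triangular family (of size `#Λ − #deep sites`) and the matching gauge-fixed lower bound are in the sequels
`…ColdWallComb` / `…ColdWallGauge`; together they give the cold-wall box ceiling WITHOUT the log.
HONEST FRAMING: elementary Fubini/Haar-invariance bookkeeping on a finite product of compact groups; nothing of E0′, NT or the gap; not Clay.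
-/

open MeasureTheory Finset
open scoped ENNReal Matrix Matrix.Norms.Frobenius
open Literature.MathematicalPhysics.QuantumFieldTheory (haarProbability sub_re_trace_eq_half_norm_sub_one_sq)
open Literature.MathematicalPhysics.QuantumLattice
open Literature.Probability.LatticeModels (glueWith glueWith_apply_mem glueWith_apply_not_mem measurable_glueWith)

noncomputable section

namespace Summit.QuantumFields.YangMills.Cruxes.UVSeamRec.ClassicalResponse.ColdWall

/-! ### §1 Updating one link of the fibre -/

section Update

variable {d : ℕ} {G : Type*} [Group G]

omit [Group G] in
/-- Updating the coordinate `ℓ` of the inner configuration and then gluing = gluing and then updating the link `ℓ`. [folklore] -/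
theorem glueWith_update (Λ : Finset (ZdEdge d)) (ζ : ↥Λ → G) (η : LGConfig d G) (ℓ : ↥Λ) (y : G) :
    glueWith Λ (Function.update ζ ℓ y) η = Function.update (glueWith Λ ζ η) ℓ.1 y := by
  classical
  funext e
  by_cases he : e ∈ Λ
  · rw [glueWith_apply_mem _ _ _ he]
    by_cases h : e = ℓ.1
    · have h' : (⟨e, he⟩ : ↥Λ) = ℓ := Subtype.ext h
      rw [h', Function.update_self, h, Function.update_self]
    · have h' : (⟨e, he⟩ : ↥Λ) ≠ ℓ := fun h'' => h (congrArg Subtype.val h'')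
      rw [Function.update_of_ne h', Function.update_of_ne h, glueWith_apply_mem _ _ _ he]
  · have h : e ≠ ℓ.1 := fun h => he (h ▸ ℓ.2)
    rw [glueWith_apply_not_mem _ _ _ he, Function.update_of_ne h, glueWith_apply_not_mem _ _ _ he]

/-- Updating a link which is not an edge of the plaquette `p` does not change the holonomy of `p`. [folklore] -/
theorem plaquetteHolonomyZd_update_of_not_mem (p : ZdPlaquette d) {e : ZdEdge d} (he : e ∉ plaquetteEdges p)
    (U : LGConfig d G) (y : G) :
    plaquetteHolonomyZd (Function.update U e y) p.1 p.2.1.1 p.2.1.2 = plaquetteHolonomyZd U p.1 p.2.1.1 p.2.1.2 := by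
  simp only [plaquetteEdges, mem_insert, mem_singleton, not_or] at he
  obtain ⟨h1, h2, h3, h4⟩ := he
  unfold plaquetteHolonomyZd
  rw [Function.update_of_ne (Ne.symm h1), Function.update_of_ne (Ne.symm h2), Function.update_of_ne (Ne.symm h3),
    Function.update_of_ne (Ne.symm h4)]

omit [Group G] in
/-- A site of `ℤ^d` is not its own neighbour: `x + e_k ≠ x`. [folklore] -/
theorem add_single_ne_self (x : Literature.Probability.LatticeModels.Site d) (k : Fin d) : x + Pi.single k (1 : ℤ) ≠ x := by
  intro h
  have h2 := congrFun h k
  simp at h2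

/-- **Updating an edge of a plaquette**: if `ℓ` is one of the four edges of `p`, the holonomy of `p` after updating `ℓ` to `y` is
`a · y · c` or `a · y⁻¹ · c` with `a, c` independent of `y` (the four edges of a plaquette of `ℤ^d` are pairwise distinct links). [folklore] -/
theorem exists_plaquetteHolonomyZd_update_eq (p : ZdPlaquette d) {ℓ : ZdEdge d} (hℓ : ℓ ∈ plaquetteEdges p) (U : LGConfig d G) :
    ∃ a c : G, (∀ y, plaquetteHolonomyZd (Function.update U ℓ y) p.1 p.2.1.1 p.2.1.2 = a * y * c) ∨
      (∀ y, plaquetteHolonomyZd (Function.update U ℓ y) p.1 p.2.1.1 p.2.1.2 = a * y⁻¹ * c) := by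
  obtain ⟨x, ⟨⟨i, j⟩, hij⟩⟩ := p
  have hij' : i ≠ j := hij.ne
  -- the four edges are pairwise distinct
  have h12 : ((x, i) : ZdEdge d) ≠ (x + Pi.single i 1, j) := fun h => hij' (Prod.mk.inj h).2
  have h13 : ((x, i) : ZdEdge d) ≠ (x + Pi.single j 1, i) := fun h => add_single_ne_self x j (Prod.mk.inj h).1.symm
  have h14 : ((x, i) : ZdEdge d) ≠ (x, j) := fun h => hij' (Prod.mk.inj h).2
  have h23 : ((x + Pi.single i 1, j) : ZdEdge d) ≠ (x + Pi.single j 1, i) := fun h => hij' (Prod.mk.inj h).2.symm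
  have h24 : ((x + Pi.single i 1, j) : ZdEdge d) ≠ (x, j) := fun h => add_single_ne_self x i (Prod.mk.inj h).1
  have h34 : ((x + Pi.single j 1, i) : ZdEdge d) ≠ (x, j) := fun h => hij' (Prod.mk.inj h).2
  simp only [plaquetteEdges, mem_insert, mem_singleton] at hℓ
  simp only [plaquetteHolonomyZd]
  rcases hℓ with rfl | rfl | rfl | rfl
  · refine ⟨1, U (x + Pi.single i 1, j) * (U (x + Pi.single j 1, i))⁻¹ * (U (x, j))⁻¹, Or.inl fun y => ?_⟩
    rw [Function.update_self, Function.update_of_ne h12.symm, Function.update_of_ne h13.symm, Function.update_of_ne h14.symm]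
    group
  · refine ⟨U (x, i), (U (x + Pi.single j 1, i))⁻¹ * (U (x, j))⁻¹, Or.inl fun y => ?_⟩
    rw [Function.update_self, Function.update_of_ne h12, Function.update_of_ne h23.symm, Function.update_of_ne h24.symm]
    group
  · refine ⟨U (x, i) * U (x + Pi.single i 1, j), (U (x, j))⁻¹, Or.inr fun y => ?_⟩
    rw [Function.update_self, Function.update_of_ne h13, Function.update_of_ne h23, Function.update_of_ne h34.symm]
  · refine ⟨U (x, i) * U (x + Pi.single i 1, j) * (U (x + Pi.single j 1, i))⁻¹, 1, Or.inr fun y => ?_⟩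
    rw [Function.update_self, Function.update_of_ne h14, Function.update_of_ne h24, Function.update_of_ne h34]
    group

end Update

/-! ### §2 The peeling step in the fibre -/

section Peeling

variable {N : ℕ} {G : Type*} [Group G] [TopologicalSpace G] [IsTopologicalGroup G] [CompactSpace G]
  [MeasurableSpace G] [BorelSpace G] [SecondCountableTopology G] (ρ : G →* Matrix (Fin N) (Fin N) ℂ)

omit [CompactSpace G] in
/-- The Boltzmann factor of one plaquette of the glued configuration is measurable in the inner configuration (continuous `ρ`). [folklore] -/
theorem measurable_fibre_boltzmann (hρ : Continuous ρ) (b : ℝ) (Λ : Finset (ZdEdge 4)) (η : LGConfig 4 G) (p : ZdPlaquette 4) :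
    Measurable fun ζ : ↥Λ → G =>
      ENNReal.ofReal (Real.exp (-(b * ((N : ℝ) - (ρ (plaquetteHolonomyZd (glueWith Λ ζ η) p.1 p.2.1.1 p.2.1.2)).trace.re)))) := by
  have hc : Continuous fun g : G => (N : ℝ) - (ρ g).trace.re :=
    continuous_const.sub (Complex.continuous_re.comp ((Continuous.matrix_trace hρ)))
  have hg : Measurable fun ζ : ↥Λ → G => glueWith Λ ζ η := measurable_glueWith Λ η
  have hhol : Measurable fun ζ : ↥Λ → G => plaquetteHolonomyZd (glueWith Λ ζ η) p.1 p.2.1.1 p.2.1.2 := by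
    unfold plaquetteHolonomyZd
    have h1 : ∀ e : ZdEdge 4, Measurable fun ζ : ↥Λ → G => glueWith Λ ζ η e := fun e => (measurable_pi_apply e).comp hg
    exact (((h1 _).mul (h1 _)).mul (h1 _).inv).mul (h1 _).inv
  exact ENNReal.measurable_ofReal.comp (Real.measurable_exp.comp ((hc.measurable.comp hhol).const_mul b).neg)

omit [SecondCountableTopology G] in
/-- The one-link integral is two-sided translation invariant: `∫ K_b(a V c) dV = ψ_ρ(b)`. [folklore] -/
theorem lintegral_boltzmann_mul_mul (b : ℝ) (a c : G) :
    ∫⁻ V, ENNReal.ofReal (Real.exp (-(b * ((N : ℝ) - (ρ (a * V * c)).trace.re)))) ∂(haarProbability G) =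
      ∫⁻ V, ENNReal.ofReal (Real.exp (-(b * ((N : ℝ) - (ρ V).trace.re)))) ∂(haarProbability G) := by
  set φ : G → ℝ≥0∞ := fun V => ENNReal.ofReal (Real.exp (-(b * ((N : ℝ) - (ρ V).trace.re)))) with hφ
  show ∫⁻ V, φ (a * V * c) ∂(haarProbability G) = ∫⁻ V, φ V ∂(haarProbability G)
  have hl := lintegral_mul_left_eq_self (μ := haarProbability G) (fun V => φ (V * c)) a
  rw [hl]
  exact lintegral_mul_right_eq_self φ c

/-- **THE PEELING STEP IN THE FIBRE.**  Let `Λ` be a finite link set of `ℤ⁴`, `η` an exterior, `p` a plaquette and `ℓ ∈ Λ` one of its edges; let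
`g ≥ 0` be a measurable function of the inner configuration NOT depending on the coordinate `ℓ`.  Then
`∫ K_b(U_p(ζ ∨ η)) g(ζ) dHaar^Λ(ζ) = ψ_ρ(b) · ∫ g dHaar^Λ` (`ψ_ρ(b) = ∫ K_b dHaar`): integrate the coordinate `ℓ` first (Mathlib `lmarginal`
at `{ℓ}`), where `U_p = a y^{±1} c` with `a, c, g` frozen. [folklore] -/
theorem lintegral_fibre_boltzmann_mul (hρ : Continuous ρ) (b : ℝ) (Λ : Finset (ZdEdge 4)) (η : LGConfig 4 G) (p : ZdPlaquette 4)
    {ℓ : ZdEdge 4} (hℓΛ : ℓ ∈ Λ) (hℓp : ℓ ∈ plaquetteEdges p) {g : (↥Λ → G) → ℝ≥0∞} (hg : Measurable g)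
    (hge : ∀ (ζ : ↥Λ → G) (y : G), g (Function.update ζ ⟨ℓ, hℓΛ⟩ y) = g ζ) :
    ∫⁻ ζ, ENNReal.ofReal (Real.exp (-(b * ((N : ℝ) - (ρ (plaquetteHolonomyZd (glueWith Λ ζ η) p.1 p.2.1.1 p.2.1.2)).trace.re)))) * g ζ
        ∂(Measure.pi fun _ : ↥Λ => haarProbability G) =
      (∫⁻ V, ENNReal.ofReal (Real.exp (-(b * ((N : ℝ) - (ρ V).trace.re)))) ∂(haarProbability G)) *
        ∫⁻ ζ, g ζ ∂(Measure.pi fun _ : ↥Λ => haarProbability G) := by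
  classical
  set e : ↥Λ := ⟨ℓ, hℓΛ⟩ with he
  set K : G → ℝ≥0∞ := fun V => ENNReal.ofReal (Real.exp (-(b * ((N : ℝ) - (ρ V).trace.re)))) with hK
  set ψ : ℝ≥0∞ := ∫⁻ V, K V ∂(haarProbability G) with hψ
  have hKm : Measurable K := by
    have hc : Continuous fun g : G => (N : ℝ) - (ρ g).trace.re :=
      continuous_const.sub (Complex.continuous_re.comp ((Continuous.matrix_trace hρ)))
    exact ENNReal.measurable_ofReal.comp (Real.measurable_exp.comp ((hc.measurable).const_mul b).neg)
  set f : (↥Λ → G) → ℝ≥0∞ := fun ζ => K (plaquetteHolonomyZd (glueWith Λ ζ η) p.1 p.2.1.1 p.2.1.2) * g ζ with hf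
  have hfm : Measurable f := (measurable_fibre_boltzmann ρ hρ b Λ η p).mul hg
  have hcm : Measurable fun ζ : ↥Λ → G => ψ * g ζ := hg.const_mul ψ
  -- the two functions have the same marginal at `{e}`
  have hmarg : ∫⋯∫⁻_{e}, f ∂(fun _ : ↥Λ => haarProbability G) =
      ∫⋯∫⁻_{e}, (fun ζ => ψ * g ζ) ∂(fun _ : ↥Λ => haarProbability G) := by
    rw [lmarginal_singleton, lmarginal_singleton]
    funext ζ
    obtain ⟨a, c, hac⟩ := exists_plaquetteHolonomyZd_update_eq p hℓp (glueWith Λ ζ η)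
    have h2 : ∀ y : G, (fun ζ => ψ * g ζ) (Function.update ζ e y) = ψ * g ζ := by
      intro y
      show ψ * g (Function.update ζ e y) = ψ * g ζ
      rw [he, hge ζ y]
    simp_rw [h2]
    rw [lintegral_const, measure_univ, mul_one]
    rcases hac with h | h
    · have h1 : ∀ y : G, f (Function.update ζ e y) = K (a * y * c) * g ζ := by
        intro y
        simp only [hf, he]
        rw [glueWith_update, h y, hge ζ y]
      simp_rw [h1]
      have hmeas : Measurable (fun y : G => K (a * y * c)) := hKm.comp ((measurable_const.mul measurable_id).mul measurable_const)
      rw [lintegral_mul_const _ hmeas, lintegral_boltzmann_mul_mul ρ b a c, mul_comm]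
    · have h1 : ∀ y : G, f (Function.update ζ e y) = K (a * y⁻¹ * c) * g ζ := by
        intro y
        simp only [hf, he]
        rw [glueWith_update, h y, hge ζ y]
      simp_rw [h1]
      have hmeas : Measurable (fun y : G => K (a * y⁻¹ * c)) := hKm.comp ((measurable_const.mul measurable_inv).mul measurable_const)
      rw [lintegral_mul_const _ hmeas, ThermalFloor.lintegral_boltzmann_conj_inv ρ b a c, mul_comm]
  have h := lintegral_eq_of_lmarginal_eq (μ := fun _ : ↥Λ => haarProbability G) {e} hfm hcm hmarg
  rw [hf] at h
  rw [h, lintegral_const_mul _ hg]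

/-! ### §3 Triangular families peel completely -/

/-- **Triangular link-indexed families of plaquettes peel completely (any exterior).**  Let `N ⊆ Λ` and let every `ℓ ∈ N` be an edge of a plaquette
`pl ℓ`, TRIANGULARLY for a rank `τ`: whenever `ℓ ∈ N` is an edge of `pl ℓ'` for another `ℓ' ∈ N`, then `τ ℓ < τ ℓ'`.  Then
`∫ ∏_{ℓ∈N} K_b(U_{pl ℓ}(ζ ∨ η)) dHaar^Λ(ζ) = ψ_ρ(b)^{#N}` — peel the link of maximal rank (it lies on no other member's plaquette) and induct. [folklore] -/
theorem lintegral_fibre_prod_boltzmann_eq (hρ : Continuous ρ) (b : ℝ) (Λ : Finset (ZdEdge 4)) (η : LGConfig 4 G)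
    {Nl : Finset (ZdEdge 4)} (hN : Nl ⊆ Λ) (pl : ZdEdge 4 → ZdPlaquette 4) (τ : ZdEdge 4 → ℕ)
    (h1 : ∀ ℓ ∈ Nl, ℓ ∈ plaquetteEdges (pl ℓ))
    (h2 : ∀ ℓ ∈ Nl, ∀ ℓ' ∈ Nl, ℓ ≠ ℓ' → ℓ ∈ plaquetteEdges (pl ℓ') → τ ℓ < τ ℓ') :
    ∫⁻ ζ, ∏ ℓ ∈ Nl, ENNReal.ofReal (Real.exp (-(b * ((N : ℝ) -
        (ρ (plaquetteHolonomyZd (glueWith Λ ζ η) (pl ℓ).1 (pl ℓ).2.1.1 (pl ℓ).2.1.2)).trace.re))))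
        ∂(Measure.pi fun _ : ↥Λ => haarProbability G) =
      (∫⁻ V, ENNReal.ofReal (Real.exp (-(b * ((N : ℝ) - (ρ V).trace.re)))) ∂(haarProbability G)) ^ Nl.card := by
  classical
  set K : G → ℝ≥0∞ := fun V => ENNReal.ofReal (Real.exp (-(b * ((N : ℝ) - (ρ V).trace.re)))) with hK
  induction' hn : Nl.card with n ih generalizing Nl
  · rw [Finset.card_eq_zero.1 hn]
    simp
  · have hne : Nl.Nonempty := by rw [← Finset.card_pos, hn]; exact Nat.succ_pos n
    obtain ⟨ℓ₀, hℓ₀, hmax⟩ := Nl.exists_max_image τ hne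
    -- `ℓ₀` lies on no other member's plaquette
    have hfree : ∀ ℓ ∈ Nl.erase ℓ₀, ℓ₀ ∉ plaquetteEdges (pl ℓ) := by
      intro ℓ hℓ hmem
      have hℓN : ℓ ∈ Nl := Finset.mem_of_mem_erase hℓ
      have hne' : ℓ₀ ≠ ℓ := (Finset.ne_of_mem_erase hℓ).symm
      have hlt := h2 ℓ₀ hℓ₀ ℓ hℓN hne' hmem
      exact absurd (hmax ℓ hℓN) (not_le.2 hlt)
    set g : (↥Λ → G) → ℝ≥0∞ :=
      fun ζ => ∏ ℓ ∈ Nl.erase ℓ₀, K (plaquetteHolonomyZd (glueWith Λ ζ η) (pl ℓ).1 (pl ℓ).2.1.1 (pl ℓ).2.1.2) with hg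
    have hgm : Measurable g :=
      Finset.measurable_prod _ fun ℓ _ => measurable_fibre_boltzmann ρ hρ b Λ η (pl ℓ)
    have hge : ∀ (ζ : ↥Λ → G) (y : G), g (Function.update ζ ⟨ℓ₀, hN hℓ₀⟩ y) = g ζ := by
      intro ζ y
      show (∏ ℓ ∈ Nl.erase ℓ₀, K (plaquetteHolonomyZd (glueWith Λ (Function.update ζ ⟨ℓ₀, hN hℓ₀⟩ y) η) (pl ℓ).1 (pl ℓ).2.1.1 (pl ℓ).2.1.2)) =
        ∏ ℓ ∈ Nl.erase ℓ₀, K (plaquetteHolonomyZd (glueWith Λ ζ η) (pl ℓ).1 (pl ℓ).2.1.1 (pl ℓ).2.1.2)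
      refine Finset.prod_congr rfl fun ℓ hℓ => ?_
      rw [glueWith_update, plaquetteHolonomyZd_update_of_not_mem (pl ℓ) (hfree ℓ hℓ)]
    have hsplit : ∀ ζ : ↥Λ → G,
        ∏ ℓ ∈ Nl, K (plaquetteHolonomyZd (glueWith Λ ζ η) (pl ℓ).1 (pl ℓ).2.1.1 (pl ℓ).2.1.2) =
          K (plaquetteHolonomyZd (glueWith Λ ζ η) (pl ℓ₀).1 (pl ℓ₀).2.1.1 (pl ℓ₀).2.1.2) * g ζ :=
      fun ζ => (Finset.mul_prod_erase Nl (fun ℓ => K (plaquetteHolonomyZd (glueWith Λ ζ η) (pl ℓ).1 (pl ℓ).2.1.1 (pl ℓ).2.1.2)) hℓ₀).symm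
    show ∫⁻ ζ, ∏ ℓ ∈ Nl, K (plaquetteHolonomyZd (glueWith Λ ζ η) (pl ℓ).1 (pl ℓ).2.1.1 (pl ℓ).2.1.2)
        ∂(Measure.pi fun _ : ↥Λ => haarProbability G) = (∫⁻ V, K V ∂(haarProbability G)) ^ (n + 1)
    simp_rw [hsplit]
    rw [lintegral_fibre_boltzmann_mul ρ hρ b Λ η (pl ℓ₀) (hN hℓ₀) (h1 ℓ₀ hℓ₀) hgm hge]
    have hcard : (Nl.erase ℓ₀).card = n := by rw [Finset.card_erase_of_mem hℓ₀, hn]; rfl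
    have hsub : Nl.erase ℓ₀ ⊆ Λ := (Finset.erase_subset _ _).trans hN
    have h1' : ∀ ℓ ∈ Nl.erase ℓ₀, ℓ ∈ plaquetteEdges (pl ℓ) := fun ℓ hℓ => h1 ℓ (Finset.mem_of_mem_erase hℓ)
    have h2' : ∀ ℓ ∈ Nl.erase ℓ₀, ∀ ℓ' ∈ Nl.erase ℓ₀, ℓ ≠ ℓ' → ℓ ∈ plaquetteEdges (pl ℓ') → τ ℓ < τ ℓ' :=
      fun ℓ hℓ ℓ' hℓ' => h2 ℓ (Finset.mem_of_mem_erase hℓ) ℓ' (Finset.mem_of_mem_erase hℓ')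
    rw [ih hsub h1' h2' hcard, pow_succ, mul_comm]

/-! ### §4 The upper bound on the fibre integral -/

/-- A triangular link-indexed family is injective: distinct links get distinct plaquettes. [folklore] -/
theorem injOn_of_triangular {Nl : Finset (ZdEdge 4)} {pl : ZdEdge 4 → ZdPlaquette 4} {τ : ZdEdge 4 → ℕ}
    (h1 : ∀ ℓ ∈ Nl, ℓ ∈ plaquetteEdges (pl ℓ))
    (h2 : ∀ ℓ ∈ Nl, ∀ ℓ' ∈ Nl, ℓ ≠ ℓ' → ℓ ∈ plaquetteEdges (pl ℓ') → τ ℓ < τ ℓ') :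
    Set.InjOn pl ↑Nl := by
  intro ℓ hℓ ℓ' hℓ' hpl
  by_contra hne
  have ha := h2 ℓ hℓ ℓ' hℓ' hne (hpl ▸ h1 ℓ hℓ)
  have hb := h2 ℓ' hℓ' ℓ hℓ (Ne.symm hne) (hpl.symm ▸ h1 ℓ' hℓ')
  omega

/-- **UPPER BOUND ON THE FIBRE INTEGRAL by peeling (every exterior).**  For a compact second-countable `G`, a continuous unitary representation `ρ`,
a finite link set `Λ` of `ℤ⁴`, an exterior `η`, `b ≥ 0` and a triangular link-indexed family `(pl ℓ)_{ℓ ∈ N}`, `N ⊆ Λ`: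
`Z_Λ(b; η) = ∫ exp(−b S_Λ(ζ ∨ η)) dHaar^Λ(ζ) ≤ ψ_ρ(b)^{#N}` — the plaquettes `pl ℓ` are distinct members of `P_Λ`, the other costs are `≥ 0`,
and the family peels completely. [folklore] -/
theorem fibreIntegral_exp_neg_mul_le_pow (hρ : Continuous ρ) (hρU : ∀ g, ρ g ∈ Matrix.unitaryGroup (Fin N) ℂ) (Λ : Finset (ZdEdge 4))
    (η : LGConfig 4 G) {b : ℝ} (hb : 0 ≤ b) {Nl : Finset (ZdEdge 4)} (hN : Nl ⊆ Λ) (pl : ZdEdge 4 → ZdPlaquette 4) (τ : ZdEdge 4 → ℕ)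
    (h1 : ∀ ℓ ∈ Nl, ℓ ∈ plaquetteEdges (pl ℓ))
    (h2 : ∀ ℓ ∈ Nl, ∀ ℓ' ∈ Nl, ℓ ≠ ℓ' → ℓ ∈ plaquetteEdges (pl ℓ') → τ ℓ < τ ℓ') :
    ∫ ζ, Real.exp (-b * wilsonBoundaryAction ρ Λ (glueWith Λ ζ η)) ∂(Measure.pi fun _ : ↥Λ => haarProbability G) ≤
      (∫⁻ V, ENNReal.ofReal (Real.exp (-(b * ((N : ℝ) - (ρ V).trace.re)))) ∂(haarProbability G)).toReal ^ Nl.card := by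
  classical
  set π₀ : Measure (↥Λ → G) := Measure.pi fun _ : ↥Λ => haarProbability G with hπ₀
  haveI hprob : IsProbabilityMeasure (haarProbability G) :=
    ⟨by simpa [haarProbability] using Measure.haarMeasure_self (G := G) (K₀ := ⊤)⟩
  haveI : IsProbabilityMeasure π₀ := by rw [hπ₀]; infer_instance
  set K : G → ℝ≥0∞ := fun V => ENNReal.ofReal (Real.exp (-(b * ((N : ℝ) - (ρ V).trace.re)))) with hK
  have hpeel := lintegral_fibre_prod_boltzmann_eq ρ hρ b Λ η hN pl τ h1 h2
  -- pointwise: `exp(−bS) ≤ ∏_{ℓ∈N} exp(−b cost_{pl ℓ})`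
  have hcost0 : ∀ (U : LGConfig 4 G) (p : ZdPlaquette 4), 0 ≤ (N : ℝ) - plaquetteObs ρ p.1 p.2.1.1 p.2.1.2 U := by
    intro U p
    unfold plaquetteObs
    rw [sub_re_trace_eq_half_norm_sub_one_sq (hρU _)]
    positivity
  have himg : Nl.image pl ⊆ plaquettesTouching Λ := by
    intro p hp
    rw [Finset.mem_image] at hp
    obtain ⟨ℓ, hℓ, rfl⟩ := hp
    rw [mem_plaquettesTouching_iff]
    exact ⟨ℓ, Finset.mem_inter.2 ⟨h1 ℓ hℓ, hN hℓ⟩⟩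
  have hpt : ∀ ζ : ↥Λ → G, ENNReal.ofReal (Real.exp (-b * wilsonBoundaryAction ρ Λ (glueWith Λ ζ η))) ≤
      ∏ ℓ ∈ Nl, K (plaquetteHolonomyZd (glueWith Λ ζ η) (pl ℓ).1 (pl ℓ).2.1.1 (pl ℓ).2.1.2) := by
    intro ζ
    set U := glueWith Λ ζ η with hU
    have hsum : ∑ ℓ ∈ Nl, ((N : ℝ) - plaquetteObs ρ (pl ℓ).1 (pl ℓ).2.1.1 (pl ℓ).2.1.2 U) ≤ wilsonBoundaryAction ρ Λ U := by
      unfold wilsonBoundaryAction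
      rw [← Finset.sum_image (f := fun p : ZdPlaquette 4 => (N : ℝ) - plaquetteObs ρ p.1 p.2.1.1 p.2.1.2 U)
        (fun ℓ hℓ ℓ' hℓ' h => injOn_of_triangular h1 h2 hℓ hℓ' h)]
      exact Finset.sum_le_sum_of_subset_of_nonneg himg fun p _ _ => hcost0 U p
    simp only [hK]
    rw [← ENNReal.ofReal_prod_of_nonneg (fun ℓ _ => (Real.exp_pos _).le), ← Real.exp_sum]
    refine ENNReal.ofReal_le_ofReal (Real.exp_le_exp.2 ?_)
    rw [Finset.sum_neg_distrib, ← Finset.mul_sum, neg_mul]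
    unfold plaquetteObs at hsum
    exact neg_le_neg (mul_le_mul_of_nonneg_left hsum hb)
  -- integrate
  have hSc : Continuous fun ζ : ↥Λ → G => wilsonBoundaryAction ρ Λ (glueWith Λ ζ η) :=
    (continuous_wilsonBoundaryAction ρ hρ Λ).comp ((continuous_glueWith_prod Λ).comp (Continuous.prodMk_right η))
  obtain ⟨C, hC⟩ : ∃ C, ∀ ζ : ↥Λ → G, |wilsonBoundaryAction ρ Λ (glueWith Λ ζ η)| ≤ C := by
    obtain ⟨ζ₀, -, hζ₀⟩ := isCompact_univ.exists_isMaxOn Set.univ_nonempty (continuous_abs.comp hSc).continuousOn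
    exact ⟨_, fun ζ => hζ₀ (Set.mem_univ ζ)⟩
  have hint : Integrable (fun ζ : ↥Λ → G => Real.exp (-b * wilsonBoundaryAction ρ Λ (glueWith Λ ζ η))) π₀ :=
    Integrable.of_bound (Real.measurable_exp.comp (hSc.measurable.const_mul _)).aestronglyMeasurable (Real.exp (|b| * C))
      (ae_of_all _ fun ζ => by
        rw [Real.norm_eq_abs, Real.abs_exp]
        refine Real.exp_le_exp.2 ?_
        have h1 : |(-b) * wilsonBoundaryAction ρ Λ (glueWith Λ ζ η)| ≤ |b| * C := by
          rw [abs_mul, abs_neg]; gcongr; exact hC ζ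
        exact (le_abs_self _).trans h1)
  have hI : ENNReal.ofReal (∫ ζ, Real.exp (-b * wilsonBoundaryAction ρ Λ (glueWith Λ ζ η)) ∂π₀) ≤
      (∫⁻ V, K V ∂(haarProbability G)) ^ Nl.card := by
    rw [ofReal_integral_eq_lintegral_ofReal hint (ae_of_all _ fun ζ => (Real.exp_pos _).le), ← hpeel]
    exact lintegral_mono hpt
  -- `ψ ≤ 1 < ⊤`
  have hψle : ∫⁻ V, K V ∂(haarProbability G) ≤ 1 := by
    calc ∫⁻ V, K V ∂(haarProbability G) ≤ ∫⁻ _V, 1 ∂(haarProbability G) := by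
          refine lintegral_mono fun V => ?_
          simp only [hK]
          rw [← ENNReal.ofReal_one]
          refine ENNReal.ofReal_le_ofReal ?_
          rw [Real.exp_le_one_iff]
          have h0 : 0 ≤ (N : ℝ) - (ρ V).trace.re := by
            rw [sub_re_trace_eq_half_norm_sub_one_sq (hρU _)]; positivity
          nlinarith
      _ = 1 := by rw [lintegral_const, measure_univ, mul_one]
  have hψtop : ∫⁻ V, K V ∂(haarProbability G) ≠ ⊤ := ne_top_of_le_ne_top ENNReal.one_ne_top hψle
  have := (ENNReal.ofReal_le_iff_le_toReal (ENNReal.pow_ne_top hψtop)).1 hI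
  rwa [ENNReal.toReal_pow] at this

/-- **The `SU(2)` reading**: for the defining representation of `SU(2)`, `b > 0`, every `Λ`, `η` and every triangular link-indexed family
`(pl ℓ)_{ℓ∈N}`: `Z_Λ(b; η) ≤ (3/(b√b))^{#N}` (`…TorusLaplaceSU2.lintegral_exp_neg_mul_two_sub_trace_le`). [folklore] -/
theorem fibreIntegral_exp_neg_mul_le_su2 (Λ : Finset (ZdEdge 4)) (η : LGConfig 4 (Matrix.specialUnitaryGroup (Fin 2) ℂ)) {b : ℝ}
    (hb : 0 < b) {Nl : Finset (ZdEdge 4)} (hN : Nl ⊆ Λ) (pl : ZdEdge 4 → ZdPlaquette 4) (τ : ZdEdge 4 → ℕ)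
    (h1 : ∀ ℓ ∈ Nl, ℓ ∈ plaquetteEdges (pl ℓ))
    (h2 : ∀ ℓ ∈ Nl, ∀ ℓ' ∈ Nl, ℓ ≠ ℓ' → ℓ ∈ plaquetteEdges (pl ℓ') → τ ℓ < τ ℓ') :
    ∫ ζ, Real.exp (-b * wilsonBoundaryAction (fundamentalRep (Fin 2)) Λ (glueWith Λ ζ η))
        ∂(Measure.pi fun _ : ↥Λ => haarProbability (Matrix.specialUnitaryGroup (Fin 2) ℂ)) ≤
      (3 / (b * Real.sqrt b)) ^ Nl.card := by
  haveI : SecondCountableTopology (Matrix.specialUnitaryGroup (Fin 2) ℂ) := secondCountableTopology_su2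
  have h := fibreIntegral_exp_neg_mul_le_pow (fundamentalRep (Fin 2)) (continuous_fundamentalRep (Fin 2)) fundamentalRep_mem_unitaryGroup
    Λ η hb.le hN pl τ h1 h2
  refine h.trans (pow_le_pow_left₀ ENNReal.toReal_nonneg ?_ _)
  have hψ := ThermalFloor.lintegral_exp_neg_mul_two_sub_trace_le hb
  have hN : ∀ V : Matrix.specialUnitaryGroup (Fin 2) ℂ,
      ((2 : ℕ) : ℝ) - (fundamentalRep (Fin 2) V).trace.re = 2 - ((V : Matrix (Fin 2) (Fin 2) ℂ).trace).re := by
    intro V; rw [Literature.MathematicalPhysics.QuantumLattice.fundamentalRep_apply]; norm_num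
  simp_rw [hN]
  exact (ENNReal.toReal_mono ENNReal.ofReal_ne_top hψ).trans (by rw [ENNReal.toReal_ofReal (by positivity)])

end Peeling

end Summit.QuantumFields.YangMills.Cruxes.UVSeamRec.ClassicalResponse.ColdWall

end
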